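import Mathlib
import Summits.Ventures.HodgeRepro.Tier4.Common.AdelicRTF
import Summits.Ventures.HodgeRepro.Tier4.Common.AdelicHaar
import Summits.Ventures.HodgeRepro.Tier4.Common.TorusInfCompact
import Summits.Ventures.HodgeRepro.Tier4.Line4.TorusProduct
import Summits.Ventures.HodgeRepro.Tier4.Line4.InnerSplit
import Summits.Ventures.HodgeRepro.Tier4.Line1.RationalPoints
import Summits.Ventures.HodgeRepro.Tier4.Line1.SecondCountableGA

/-!
# Tier4/Line4/IntegArch — C-L4-INTEG, the three PROPER-free inner integrands of the PRODUCT display ((C-hA), (C-hB),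
(C-hIinf) of t4-plan-4 g3's Part 8): the archimedean inner integrand over the compact `T′_∞`, the finite inner
integrand with compact support in `T′_f`, and `a ↦ χ(a) I_∞(a)` over the compact `T_∞`

Blind re-derivation cell `pub-hodge-repro`, Tier 4 (README §9–§10), seat t4-L1-p5 (prover, gen 4; seat of record
LINE L1, working LINE L4's cut C-L4-INTEG — lead g386's (R-6′) S14693: the PROPER-free ten are this seat's; the
other seven are `Tier4/Line4/IntegFolded.lean` p697292).  Target tree path
`lean/Summits/Ventures/HodgeRepro/Tier4/Line4/IntegArch.lean`.  Statements VERBATIM from HOME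
proofs/t4-plan-4/work/Integ-Concat-v2.lean (efc313b641e3a2f3 · 671) L555–L583 (crit-1 g7's audit S14664: «all 13
true as stated, none vacuous»; (C-hB) in the trimmed PROPER-free form); the only edit is the `_`-prefix on the binders
a proof does not touch (the gate's `unusedVariables` lint; Props and positions unchanged).

WHAT IS PROVED (Mathlib only beyond the tree's definitions; no printed input).
* (C-hA) `integrable_conj_chi'_mul_Finf` — on the COMPACT group `T′_∞` (the displayed `[CompactSpace (torusInf' W)]`,
  typer-2's TorusInfCompact) a continuous function is integrable for the Haar measure: continuity of
  `a ↦ conj χ′(a) F_∞(t_∞⁻¹ γ₀,∞ a)` + `HasCompactSupport.of_compactSpace` + `Continuous.integrable_of_hasCompactSupport`.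
* (C-hB) `integrable_conj_chi'_mul_Ffin` — the finite inner integrand `b ↦ conj χ′(b) F_f(t_f⁻¹ γ₀,f b)` is continuous
  and has COMPACT SUPPORT in `T′_f`: its argument lies in `G(𝔸_f)` (`ofFinPart_mem_finitePart`, `b ∈ T′_f`), so by the
  support clause `hFsupp` a non-zero value forces `t_f⁻¹ γ₀,f b ∈ C_f`, i.e. `b ∈ (t_f⁻¹ γ₀,f)⁻¹ · C_f`, whose preimage
  under the CLOSED EMBEDDING `T′_f ↪ T′(𝔸) ↪ G(𝔸)` (`isClosed_torusFin'` ∘ `isClosed_torusT'`) is compact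
  (`IsClosedEmbedding.isCompact_preimage`); no PROPER (crit-1 S14664).
* (C-hIinf) `integrable_chi_mul_innerInf` — `a ↦ I_∞(a)` is CONTINUOUS on `T_∞` by dominated convergence
  (`continuous_of_dominated`): the integrand is jointly continuous on the compact `T_∞ × T′_∞`, hence bounded by a
  constant `C`, which is integrable for the finite Haar measure of the compact `T′_∞`; then `a ↦ χ(a) I_∞(a)` is a
  continuous function on the compact `T_∞`, integrable for its Haar measure.

Nothing here says anything about the status of the Hodge conjecture for CM abelian varieties, which is NOT proved
(HC_CM is NOT proved by anyone in this repository).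
-/

set_option autoImplicit false

noncomputable section

namespace Summit.Ventures.HodgeRepro.Tier4.Line4

open Summit.Ventures.HodgeRepro.Tier4.Common Summit.Ventures.HodgeRepro.Tier4.Line1 MeasureTheory NumberField
  Topology Set

open scoped ComplexConjugate Pointwise

section Arch

variable {k : Type} [Field k] [NumberField k] (W : PlaneData k) [MeasurableSpace (GA W)] [BorelSpace (GA W)]
  (R : RTFData W)

/-- (C-hA) the archimedean inner integrand is integrable over the compact `T′_∞`. -/
theorem integrable_conj_chi'_mul_Finf [CompactSpace (torusInf' W)] (hc' : Continuous R.chi')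
    (_hu' : ∀ a, ‖R.chi' a‖ = 1) (νinf' : Measure (torusInf' W)) [νinf'.IsHaarMeasure]
    (Finf : GA W → ℂ) (hFc : Continuous Finf) (γ₀ : GA W) (t : torusT W) :
    Integrable (fun a : torusInf' W => conj (R.chi' (a : torusT' W)) *
      Finf ((GA.ofInfPart W t)⁻¹ * GA.ofInfPart W γ₀ * ((a : torusT' W) : GA W))) νinf' := by
  have hcont : Continuous (fun a : torusInf' W => conj (R.chi' (a : torusT' W)) *
      Finf ((GA.ofInfPart W t)⁻¹ * GA.ofInfPart W γ₀ * ((a : torusT' W) : GA W))) :=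
    (Complex.continuous_conj.comp (hc'.comp continuous_subtype_val)).mul
      (hFc.comp (continuous_const.mul (continuous_subtype_val.comp continuous_subtype_val)))
  exact hcont.integrable_of_hasCompactSupport (HasCompactSupport.of_compactSpace _)

/-- (C-hB) the finite inner integrand has compact support in `b` — `T′_f ∩ (γ₀,f⁻¹ t_f · C_f)`, `torusFin'` closed —
and is bounded (crit-1 S14664: no PROPER needed). -/
theorem integrable_conj_chi'_mul_Ffin (hc' : Continuous R.chi') (_hu' : ∀ a, ‖R.chi' a‖ = 1)
    (νf' : Measure (torusFin' W)) [νf'.IsHaarMeasure] (Ffin : GA W → ℂ) (hFc : Continuous Ffin)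
    (Cf : Set (GA W)) (hCf : IsCompact Cf) (hFsupp : ∀ g ∈ finitePart W, Ffin g ≠ 0 → g ∈ Cf)
    (γ₀ : GA W) (t : torusT W) :
    Integrable (fun b : torusFin' W => conj (R.chi' (b : torusT' W)) *
      Ffin ((GA.ofFinPart W t)⁻¹ * GA.ofFinPart W γ₀ * ((b : torusT' W) : GA W))) νf' := by
  haveI := t2Space_GA W
  have hcont : Continuous (fun b : torusFin' W => conj (R.chi' (b : torusT' W)) *
      Ffin ((GA.ofFinPart W t)⁻¹ * GA.ofFinPart W γ₀ * ((b : torusT' W) : GA W))) :=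
    (Complex.continuous_conj.comp (hc'.comp continuous_subtype_val)).mul
      (hFc.comp (continuous_const.mul (continuous_subtype_val.comp continuous_subtype_val)))
  -- the closed embedding `T′_f ↪ T′(𝔸) ↪ G(𝔸)`
  have hemb : IsClosedEmbedding (fun b : torusFin' W => ((b : torusT' W) : GA W)) :=
    (Common.isClosed_torusT' W).isClosedEmbedding_subtypeVal.comp (isClosed_torusFin' W).isClosedEmbedding_subtypeVal
  have hK : IsCompact ((fun b : torusFin' W => ((b : torusT' W) : GA W)) ⁻¹'
      (((GA.ofFinPart W t)⁻¹ * GA.ofFinPart W γ₀)⁻¹ • Cf)) :=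
    hemb.isCompact_preimage (hCf.smul _)
  have hsupp : HasCompactSupport (fun b : torusFin' W => conj (R.chi' (b : torusT' W)) *
      Ffin ((GA.ofFinPart W t)⁻¹ * GA.ofFinPart W γ₀ * ((b : torusT' W) : GA W))) := by
    refine HasCompactSupport.of_support_subset_isCompact hK ?_
    intro b hb
    have hne : Ffin ((GA.ofFinPart W t)⁻¹ * GA.ofFinPart W γ₀ * ((b : torusT' W) : GA W)) ≠ 0 := by
      intro h0
      exact (Function.mem_support.1 hb) (by simp [h0])
    have hmem : (GA.ofFinPart W t)⁻¹ * GA.ofFinPart W γ₀ * ((b : torusT' W) : GA W) ∈ finitePart W :=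
      (finitePart W).mul_mem ((finitePart W).mul_mem ((finitePart W).inv_mem (ofFinPart_mem_finitePart W _))
        (ofFinPart_mem_finitePart W _)) (Subgroup.mem_subgroupOf.1 b.2)
    have hCf' := hFsupp _ hmem hne
    show ((b : torusT' W) : GA W) ∈ ((GA.ofFinPart W t)⁻¹ * GA.ofFinPart W γ₀)⁻¹ • Cf
    rw [Set.mem_inv_smul_set_iff, smul_eq_mul]
    exact hCf'
  exact hcont.integrable_of_hasCompactSupport hsupp

/-- (C-hIinf) `a ↦ χ(a) I_∞(a)` is integrable over the compact `T_∞`. -/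
theorem integrable_chi_mul_innerInf [CompactSpace (torusInf W)] [CompactSpace (torusInf' W)]
    (hc : Continuous R.chi) (_hu : ∀ a, ‖R.chi a‖ = 1) (hc' : Continuous R.chi') (_hu' : ∀ a, ‖R.chi' a‖ = 1)
    (νinf : Measure (torusInf W)) [νinf.IsHaarMeasure] (νinf' : Measure (torusInf' W)) [νinf'.IsHaarMeasure]
    (Finf : GA W → ℂ) (hFc : Continuous Finf) (γ₀ : GA W) :
    Integrable (fun a : torusInf W => R.chi a * innerInf W R Finf γ₀ νinf' a) νinf := by
  haveI : SecondCountableTopology (GA W) := secondCountable_GA W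
  haveI : SecondCountableTopology (torusT W) :=
    TopologicalSpace.Subtype.secondCountableTopology (torusT W : Set (GA W))
  haveI : SecondCountableTopology (torusInf W) :=
    TopologicalSpace.Subtype.secondCountableTopology (torusInf W : Set (torusT W))
  -- the integrand is jointly continuous on the compact `T_∞ × T′_∞`, hence bounded
  have hGc : Continuous (fun p : torusInf W × torusInf' W => conj (R.chi' (p.2 : torusT' W)) *
      Finf ((((p.1 : torusT W) : GA W))⁻¹ * GA.ofInfPart W γ₀ * ((p.2 : torusT' W) : GA W))) :=
    (Complex.continuous_conj.comp (hc'.comp (continuous_subtype_val.comp continuous_snd))).mul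
      (hFc.comp (((continuous_subtype_val.comp (continuous_subtype_val.comp continuous_fst)).inv.mul
        continuous_const).mul (continuous_subtype_val.comp (continuous_subtype_val.comp continuous_snd))))
  obtain ⟨C, hC⟩ := hGc.bounded_above_of_compact_support (HasCompactSupport.of_compactSpace _)
  -- `a ↦ I_∞(a)` is continuous (dominated convergence with the constant bound on the finite Haar measure)
  have hcontI : Continuous fun a : torusInf W => innerInf W R Finf γ₀ νinf' a := by
    unfold innerInf
    refine continuous_of_dominated (bound := fun _ => C) (fun a => ?_)
      (fun a => ae_of_all _ fun a' => hC (a, a')) (integrable_const C) (ae_of_all _ fun a' => ?_)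
    · exact ((Complex.continuous_conj.comp (hc'.comp continuous_subtype_val)).mul
        (hFc.comp (continuous_const.mul (continuous_subtype_val.comp continuous_subtype_val)))).aestronglyMeasurable
    · exact continuous_const.mul (hFc.comp
        (((continuous_subtype_val.comp continuous_subtype_val).inv.mul continuous_const).mul continuous_const))
  exact ((hc.comp continuous_subtype_val).mul hcontI).integrable_of_hasCompactSupport
    (HasCompactSupport.of_compactSpace _)

end Arch

end Summit.Ventures.HodgeRepro.Tier4.Line4

end
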